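import Mathlib.Combinatorics.SimpleGraph.Prod
import Literature.InformationTheory.QuantumCodes.ToricLayout
import Literature.InformationTheory.QuantumCodes.TwoBlockTannerGraph
import HarnessLib

/-!
# The two degree-3 layers of a weight-(3,3) two-block Tanner graph are unions of "wheel graphs"
# (Bravyi et al. 2024, Lemma 2 — the combinatorial structure behind "thickness ≤ 2"), part 1

Bravyi–Cross–Gambetta–Maslov–Rall–Yoder [BravyiEtAl2024, §5 Lemma 2]: "The Tanner graph `G` of the code
`QC(A,B)` has thickness `θ ≤ 2` … Each planar layer of `G` is a degree-3 graph."  Proof (printed):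
"Partition `G` into subgraphs `G_A = (V, E_A)` and `G_B = (V, E_B)` that describe CSS codes with check
matrices `H^X_A = [A₂+A₃ | B₃]`, `H^Z_A = [B₃ᵀ | A₂ᵀ+A₃ᵀ]`, `H^X_B = [A₁ | B₁+B₂]`,
`H^Z_B = [B₁ᵀ+B₂ᵀ | A₁ᵀ]`. Since `A = A₁+A₂+A₃` and `B = B₁+B₂+B₃`, every edge of `G` appears either in
`G_A` or `G_B` … `G_A` and `G_B` are regular degree-3 graphs … each connected component of `G_A` can be
represented by a 'wheel graph' … two disjoint cycles of the same length … interconnected by radial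
edges. The outer cycle alternates between `X`-check and `L`-data vertices … [its] length is equal to
the order of `A₃A₂ᵀ` … The inner cycle alternates between `Z`-check and `R`-data vertices … Radial
edges are generated by the matrix `B₃` … wheel graphs are planar … Thus `G_A` and `G_B` are planar."

What is PROVED in this file and its sequel `TwoBlockWheelComponents.lean` (every finite abelian group
`G`, the tree's `AbelianTwoBlock.css a b`; the BB code is `G = ℤ_ℓ × ℤ_m`) — everything in that proof
EXCEPT the planarity of wheel graphs (Mathlib has no notion of planar graph, so "thickness ≤ 2"
itself is not stated):

* `tannerGraph_eq_sup_of_add`, `tannerGraph_disjoint_of_add`: if `a = a' + a''`, `b = b' + b''` with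
  disjoint supports, the Tanner graph of `css a b` is the EDGE-DISJOINT union of the Tanner graphs of
  `css a' b'` and `css a'' b''` (these are the printed `G_A = Tanner(H^X_A, H^Z_A)` and `G_B`);
* `prismGraph n` = the printed "wheel graph": the Cayley cycle `ℤ_n` box `K₂` — two `n`-cycles joined
  by `n` radial edges (Mathlib `SimpleGraph.addCayley {1} □ ⊤`);
* for a "(2,1)-pair" — `supp a = {s, s'}` (`s ≠ s'`), `supp b = {t}`, i.e. `H^X_A = [A₂+A₃ | B₃]` — the
  explicit WHEEL `wheelMap s s' t i : ℤ_{2p} × Bool → V` through `X i` (`p = ord(s' − s)`, outer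
  cycle `X, L, X, L, …`, inner cycle `R, Z, R, Z, …`, radial edges `X–R`, `L–Z`) is a graph
  homomorphism from `prismGraph (2p)` (`wheelMap_adj_add_one`, `wheelMap_adj_spoke`), injective
  (`wheelMap_injective`), and LOCALLY ONTO: every Tanner-graph neighbour of a wheel vertex is the wheel
  vertex at a prism-adjacent position (`exists_prism_adj_of_adj_wheelMap`).

The sequel turns this into "every connected component of a layer is isomorphic to a wheel graph" and
assembles Lemma 2 (minus planarity) for weight-(3,3) codes.

## References (locators read on the page)
* [BravyiEtAl2024] Nature 627 (2024) 778 = arXiv:2308.07915, §5 Lemma 2 and its proof (held text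
  paper:arxiv-2308.07915 chunk p0010 L49–95, p0011 L1–5).

No named facts, no instances, no notation (Mathlib's `□` is `SimpleGraph.boxProd`).
-/

namespace Literature.InformationTheory.QuantumCodes

open SimpleGraph

/-! ### The wheel (prism) graph -/

/-- The "wheel graph" of [BravyiEtAl2024, Lemma 2]: two `n`-cycles ("outer" `β = false`, "inner"
`β = true`) joined by `n` radial edges — the box product of the Cayley cycle on `ℤ_n` (generator `1`)
with `K₂`. [cite: BravyiEtAl2024, proof of Lemma 2 "A wheel graph consists of two disjoint cycles of the same length p interconnected by p radial edges" (arXiv:2308.07915 chunk p0010 L72–73)] -/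
def prismGraph (n : ℕ) : SimpleGraph (ZMod n × Bool) :=
  SimpleGraph.addCayley ({(1 : ZMod n)} : Set (ZMod n)) □ (⊤ : SimpleGraph Bool)

/-- Adjacency in the wheel graph: same layer and consecutive positions, or same position and
different layers (a radial edge). [cite: BravyiEtAl2024, proof of Lemma 2 (arXiv:2308.07915 chunk p0010 L72–73)] -/
theorem prismGraph_adj_iff {n : ℕ} (u v : ZMod n × Bool) :
    (prismGraph n).Adj u v ↔
      (u.1 ≠ v.1 ∧ (u.1 + 1 = v.1 ∨ u.1 = v.1 + 1) ∧ u.2 = v.2) ∨ (u.2 ≠ v.2 ∧ u.1 = v.1) := by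
  rw [prismGraph, boxProd_adj, addCayley_adj', top_adj]
  simp only [Set.mem_singleton_iff, exists_eq_left, and_assoc]

/-! ### Splitting the Tanner graph along a splitting of the supports -/

/-- Over `𝔽₂`, if at most one of `x, y` is non-zero then `x + y ≠ 0 ↔ x ≠ 0 ∨ y ≠ 0`. [folklore] -/
private theorem add_ne_zero_iff_of_disjoint {x y : ZMod 2} (h : x = 0 ∨ y = 0) :
    x + y ≠ 0 ↔ x ≠ 0 ∨ y ≠ 0 := by
  rcases h with rfl | rfl <;> simp

namespace AbelianTwoBlock

variable {G : Type*} [Fintype G] [AddCommGroup G]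

/-- **"Every edge of `G` appears either in `G_A` or `G_B`"**: if `a = a' + a''` and `b = b' + b''` with
disjoint supports (over `𝔽₂`: never both non-zero), the Tanner graph of `css a b` is the union of the
Tanner graphs of `css a' b'` and `css a'' b''`.
[cite: BravyiEtAl2024, proof of Lemma 2 "Since A = A₁+A₂+A₃ and B = B₁+B₂+B₃, every edge of G appears either in G_A or G_B" (arXiv:2308.07915 chunk p0010 L58–61)] -/
theorem tannerGraph_eq_sup_of_add (a' a'' b' b'' : G → ZMod 2) (ha : ∀ g, a' g = 0 ∨ a'' g = 0)
    (hb : ∀ g, b' g = 0 ∨ b'' g = 0) :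
    (css (a' + a'') (b' + b'')).tannerGraph = (css a' b').tannerGraph ⊔ (css a'' b'').tannerGraph := by
  ext x y
  rw [sup_adj]
  rcases x with (i | i) | (j | j) <;> rcases y with (i' | i') | (j' | j') <;>
    simp only [CSSCode.not_adj_check_check, CSSCode.not_adj_qubit_qubit, false_or, adj_vX_vL,
      adj_vX_vR, adj_vZ_vL, adj_vZ_vR, adj_vL_vX, adj_vR_vX, adj_vL_vZ, adj_vR_vZ, Pi.add_apply] <;>
    first
    | exact add_ne_zero_iff_of_disjoint (ha _)
    | exact add_ne_zero_iff_of_disjoint (hb _)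

/-- The two layers are EDGE-DISJOINT ("Partition `G` into subgraphs `G_A = (V,E_A)` and
`G_B = (V,E_B)`"). [cite: BravyiEtAl2024, proof of Lemma 2 (arXiv:2308.07915 chunk p0010 L54–61)] -/
theorem tannerGraph_disjoint_of_add (a' a'' b' b'' : G → ZMod 2) (ha : ∀ g, a' g = 0 ∨ a'' g = 0)
    (hb : ∀ g, b' g = 0 ∨ b'' g = 0) :
    Disjoint (css a' b').tannerGraph (css a'' b'').tannerGraph := by
  rw [disjoint_left]
  rintro ((i | i) | (j | j)) ((i' | i') | (j' | j')) h1 h2 <;>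
    simp only [CSSCode.not_adj_check_check, CSSCode.not_adj_qubit_qubit, adj_vX_vL, adj_vX_vR,
      adj_vZ_vL, adj_vZ_vR, adj_vL_vX, adj_vR_vX, adj_vL_vZ, adj_vR_vZ] at h1 h2 <;>
    first
    | exact (ha _).elim h1 h2
    | exact (hb _).elim h1 h2

/-! ### A (2,1)-pair: the wheel through an `X`-check -/

omit [Fintype G] in
/-- `i − j = s ↔ j = i − s`. [folklore] -/
private theorem sub_eq_iff_eq_sub' {i j s : G} : i - j = s ↔ j = i - s := by
  constructor
  · rintro rfl; abel
  · rintro rfl; abel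

/-- The wheel through `X i` for a (2,1)-pair `supp a = {s, s'}`, `supp b = {t}` (`δ = s' − s`, group
element `g = k•δ` along the cycle): outer layer `X (i − g)` / `L (i − g − s')`, inner layer
`R (i − g − t)` / `Z (i − g − s' − t)`, by (layer, parity).
[cite: BravyiEtAl2024, proof of Lemma 2 "The outer cycle alternates between X-check and L-data vertices … The inner cycle … between Z-check and R-data vertices" (arXiv:2308.07915 chunk p0010 L74–93)] -/
def wheelVertex (s' t i : G) : Bool → Bool → G → (G ⊕ G) ⊕ (G ⊕ G)
  | false, false, g => vX (i - g)
  | false, true, g => vL (i - g - s')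
  | true, false, g => vR (i - g - t)
  | true, true, g => vZ (i - g - s' - t)

omit [Fintype G] in
/-- `wheelVertex` is injective in `(layer, parity, g)`. [cite: BravyiEtAl2024, proof of Lemma 2 (arXiv:2308.07915 chunk p0010 L74–93)] -/
theorem wheelVertex_injective (s' t i : G) {β ε β' ε' : Bool} {g g' : G}
    (h : wheelVertex s' t i β ε g = wheelVertex s' t i β' ε' g') : β = β' ∧ ε = ε' ∧ g = g' := by
  cases β <;> cases ε <;> cases β' <;> cases ε' <;>
    simp_all [wheelVertex, vL, vX, vZ, vR, sub_left_inj, sub_right_inj]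

/-- **The wheel map** `ℤ_{2p} × Bool → vertices`, `p = ord(s' − s)`: position `c` on layer `β` goes
to the vertex of parity `c mod 2` over `g = ⌊c/2⌋ • (s' − s)`.
[cite: BravyiEtAl2024, proof of Lemma 2 "The length of the outer cycle is equal to the order of the matrix A₃A₂ᵀ" (arXiv:2308.07915 chunk p0010 L80–82)] -/
noncomputable def wheelMap (s s' t i : G) (u : ZMod (2 * addOrderOf (s' - s)) × Bool) :
    (G ⊕ G) ⊕ (G ⊕ G) :=
  wheelVertex s' t i u.2 (par u.1) (torusHom (s' - s) (s' - s) (half u.1, 0))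

/-- Unfolding of the wheel map. [cite: BravyiEtAl2024, proof of Lemma 2 (arXiv:2308.07915 chunk p0010 L74–93)] -/
theorem wheelMap_apply (s s' t i : G) (c : ZMod (2 * addOrderOf (s' - s))) (β : Bool) :
    wheelMap s s' t i (c, β) = wheelVertex s' t i β (par c) (torusHom (s' - s) (s' - s) (half c, 0)) :=
  rfl

/-- The parametrisation `k ↦ k•δ` of the cycle is injective on `ℤ_{ord δ}`. [folklore] -/
private theorem torusHom_fst_injective (δ : G) :
    Function.Injective fun k : ZMod (addOrderOf δ) => torusHom δ δ (k, 0) := by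
  haveI : NeZero (addOrderOf δ) := ⟨(addOrderOf_pos δ).ne'⟩
  intro k k' h
  simp only [torusHom_apply, ZMod.val_zero, zero_nsmul, add_zero] at h
  exact ZMod.val_injective _ (nsmul_injOn_Iio_addOrderOf (ZMod.val_lt k) (ZMod.val_lt k') h)

/-- **The wheel map is injective.** [cite: BravyiEtAl2024, proof of Lemma 2 "two disjoint cycles of the same length" (arXiv:2308.07915 chunk p0010 L72–82)] -/
theorem wheelMap_injective (s s' t i : G) : Function.Injective (wheelMap s s' t i) := by
  haveI : NeZero (addOrderOf (s' - s)) := ⟨(addOrderOf_pos _).ne'⟩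
  rintro ⟨c, β⟩ ⟨c', β'⟩ h
  obtain ⟨h1, h2, h3⟩ := wheelVertex_injective s' t i h
  have h4 : half c = half c' := torusHom_fst_injective (s' - s) h3
  exact Prod.ext (eq_of_half_eq_of_par_eq h4 h2) h1

section Wheel

variable {a b : G → ZMod 2} {s s' t : G}
  (ha : ∀ g, a g ≠ 0 ↔ g = s ∨ g = s') (hb : ∀ g, b g ≠ 0 ↔ g = t)
include ha hb

/-- Neighbours of an `X`-check in a (2,1)-pair: `L (i−s)`, `L (i−s')`, `R (i−t)`.
[cite: BravyiEtAl2024, proof of Lemma 2 "Each X-check vertex is connected to a pair of data vertices i₁,i₂ ∈ L via the matrices A₂, A₃ and a data vertex i₃ ∈ R via the matrix B₃" (arXiv:2308.07915 chunk p0010 L64–66)] -/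
theorem adj_vX_iff_pair21 (i : G) (y : (G ⊕ G) ⊕ (G ⊕ G)) :
    (css a b).tannerGraph.Adj (vX i) y ↔ y = vL (i - s) ∨ y = vL (i - s') ∨ y = vR (i - t) := by
  rcases y with (i' | i') | (j | j)
  · simp [vX, vL, vR]
  · simp [vX, vL, vR]
  · rw [adj_vX_vL, ha]; simp [vL, vR, sub_eq_iff_eq_sub']
  · rw [adj_vX_vR, hb]; simp [vL, vR, sub_eq_iff_eq_sub']

/-- Neighbours of a `Z`-check in a (2,1)-pair: `R (i+s)`, `R (i+s')`, `L (i+t)`.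
[cite: BravyiEtAl2024, proof of Lemma 2 "Each Z-check vertex is connected to a pair of data vertices i₁,i₂ ∈ R via the matrices A₂ᵀ, A₃ᵀ and a data vertex i₃ ∈ L via the matrix B₃ᵀ" (arXiv:2308.07915 chunk p0010 L67–69)] -/
theorem adj_vZ_iff_pair21 (i : G) (y : (G ⊕ G) ⊕ (G ⊕ G)) :
    (css a b).tannerGraph.Adj (vZ i) y ↔ y = vR (s + i) ∨ y = vR (s' + i) ∨ y = vL (t + i) := by
  rcases y with (i' | i') | (j | j)
  · simp [vZ, vL, vR]
  · simp [vZ, vL, vR]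
  · rw [adj_vZ_vL, hb]; simp [vL, vR, sub_eq_iff_eq_add]
  · rw [adj_vZ_vR, ha]; simp [vL, vR, sub_eq_iff_eq_add]

/-- Neighbours of an `L`-qubit in a (2,1)-pair: `X (s+j)`, `X (s'+j)`, `Z (j−t)`.
[cite: BravyiEtAl2024, proof of Lemma 2 (arXiv:2308.07915 chunk p0010 L64–69)] -/
theorem adj_vL_iff_pair21 (j : G) (y : (G ⊕ G) ⊕ (G ⊕ G)) :
    (css a b).tannerGraph.Adj (vL j) y ↔ y = vX (s + j) ∨ y = vX (s' + j) ∨ y = vZ (j - t) := by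
  rcases y with (i | i) | (j' | j')
  · rw [adj_vL_vX, ha]; simp [vX, vZ, sub_eq_iff_eq_add]
  · rw [adj_vL_vZ, hb]; simp [vX, vZ, sub_eq_iff_eq_sub']
  · simp [vX, vZ, vL]
  · simp [vX, vZ, vL]

/-- Neighbours of an `R`-qubit in a (2,1)-pair: `Z (j−s)`, `Z (j−s')`, `X (t+j)`.
[cite: BravyiEtAl2024, proof of Lemma 2 (arXiv:2308.07915 chunk p0010 L64–69)] -/
theorem adj_vR_iff_pair21 (j : G) (y : (G ⊕ G) ⊕ (G ⊕ G)) :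
    (css a b).tannerGraph.Adj (vR j) y ↔ y = vZ (j - s) ∨ y = vZ (j - s') ∨ y = vX (t + j) := by
  rcases y with (i | i) | (j' | j')
  · rw [adj_vR_vX, hb]; simp [vX, vZ, sub_eq_iff_eq_add]
  · rw [adj_vR_vZ, ha]; simp [vX, vZ, sub_eq_iff_eq_sub']
  · simp [vX, vZ, vR]
  · simp [vX, vZ, vR]

end Wheel

section WheelHom

variable {a b : G → ZMod 2} {s s' t : G} (hs : a s ≠ 0) (hs' : a s' ≠ 0) (ht : b t ≠ 0)
include hs hs' ht

omit ht in
/-- **Cycle edges of the wheel are Tanner-graph edges**: `f (c, β) — f (c+1, β)` (outer: "edges …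
generated by `A₃` … and `A₂ᵀ`"; inner: "`A₃ᵀ` … and `A₂`").
[cite: BravyiEtAl2024, proof of Lemma 2 (arXiv:2308.07915 chunk p0010 L76–90)] -/
theorem wheelMap_adj_add_one (i : G) (c : ZMod (2 * addOrderOf (s' - s))) (β : Bool) :
    (css a b).tannerGraph.Adj (wheelMap s s' t i (c, β)) (wheelMap s s' t i (c + 1, β)) := by
  haveI : NeZero (addOrderOf (s' - s)) := ⟨(addOrderOf_pos _).ne'⟩
  set g := torusHom (s' - s) (s' - s) (half c, 0) with hg
  cases hc : par c
  · obtain ⟨h1, h2⟩ := half_par_add_one_of_even c hc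
    cases β
    · simp only [wheelMap_apply, hc, h1, h2, wheelVertex, ← hg, adj_vX_vL]
      convert hs' using 2; abel
    · simp only [wheelMap_apply, hc, h1, h2, wheelVertex, ← hg, adj_vR_vZ]
      convert hs' using 2; abel
  · obtain ⟨h1, h2⟩ := half_par_add_one_of_odd c hc
    have hstep : torusHom (s' - s) (s' - s) (half c + 1, 0) = g + (s' - s) :=
      torusHom_add_one_fst _ _ _ _
    cases β
    · simp only [wheelMap_apply, hc, h1, h2, wheelVertex, hstep, ← hg, adj_vL_vX]
      convert hs using 2; abel
    · simp only [wheelMap_apply, hc, h1, h2, wheelVertex, hstep, ← hg, adj_vZ_vR]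
      convert hs using 2; abel

omit hs hs' in
/-- **Radial edges of the wheel are Tanner-graph edges**: `f (c, outer) — f (c, inner)` ("Radial edges
are generated by the matrix `B₃`"). [cite: BravyiEtAl2024, proof of Lemma 2 (arXiv:2308.07915 chunk p0010 L91–92)] -/
theorem wheelMap_adj_spoke (i : G) (c : ZMod (2 * addOrderOf (s' - s))) :
    (css a b).tannerGraph.Adj (wheelMap s s' t i (c, false)) (wheelMap s s' t i (c, true)) := by
  cases hc : par c
  · simp only [wheelMap_apply, hc, wheelVertex, adj_vX_vR]
    convert ht using 2; abel
  · simp only [wheelMap_apply, hc, wheelVertex, adj_vL_vZ]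
    convert ht using 2; abel

/-- The wheel map is a graph homomorphism `prismGraph (2p) → Tanner graph`.
[cite: BravyiEtAl2024, proof of Lemma 2 (arXiv:2308.07915 chunk p0010 L74–93)] -/
theorem wheelMap_adj_of_prism_adj (i : G) {u v : ZMod (2 * addOrderOf (s' - s)) × Bool}
    (h : (prismGraph (2 * addOrderOf (s' - s))).Adj u v) :
    (css a b).tannerGraph.Adj (wheelMap s s' t i u) (wheelMap s s' t i v) := by
  obtain ⟨c, β⟩ := u
  obtain ⟨c', β'⟩ := v
  rw [prismGraph_adj_iff] at h
  rcases h with ⟨_, h | h, hβ⟩ | ⟨hβ, hc⟩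
  · simp only at h hβ; subst h; subst hβ
    exact wheelMap_adj_add_one hs hs' i c β
  · simp only at h hβ; subst h; subst hβ
    exact (wheelMap_adj_add_one hs hs' i c' β).symm
  · simp only at hβ hc; subst hc
    cases β <;> cases β'
    · exact absurd rfl hβ
    · exact wheelMap_adj_spoke ht i c
    · exact (wheelMap_adj_spoke ht i c).symm
    · exact absurd rfl hβ

end WheelHom

section WheelLocal

variable {a b : G → ZMod 2} {s s' t : G}
  (ha : ∀ g, a g ≠ 0 ↔ g = s ∨ g = s') (hss : s ≠ s') (hb : ∀ g, b g ≠ 0 ↔ g = t)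
include ha hss hb

omit ha hb in
/-- For `s ≠ s'` the wheel has at least `4` positions per layer: `2 · ord(s' − s) ≥ 4`, so `c − 1`,
`c`, `c + 1` are pairwise distinct. [cite: BravyiEtAl2024, proof of Lemma 2 (arXiv:2308.07915 chunk p0010 L80–82)] -/
theorem two_le_addOrderOf_sub : 2 ≤ addOrderOf (s' - s) := by
  have h1 := addOrderOf_pos (s' - s)
  have hne : addOrderOf (s' - s) ≠ 1 := by
    rw [Ne, AddMonoid.addOrderOf_eq_one_iff, sub_eq_zero]; exact fun h => hss h.symm
  omega

/-- **Local structure of the wheel**: every Tanner-graph neighbour of a wheel vertex is the wheel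
vertex at a prism-adjacent position. [cite: BravyiEtAl2024, proof of Lemma 2 (outer/inner cycles and radial edges; arXiv:2308.07915 chunk p0010 L74–93)] -/
theorem exists_prism_adj_of_adj_wheelMap (i : G) (u : ZMod (2 * addOrderOf (s' - s)) × Bool)
    (y : (G ⊕ G) ⊕ (G ⊕ G)) (h : (css a b).tannerGraph.Adj (wheelMap s s' t i u) y) :
    ∃ u', (prismGraph (2 * addOrderOf (s' - s))).Adj u u' ∧ wheelMap s s' t i u' = y := by
  haveI : NeZero (addOrderOf (s' - s)) := ⟨(addOrderOf_pos _).ne'⟩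
  have h2 := two_le_addOrderOf_sub hss
  haveI : NeZero (2 * addOrderOf (s' - s)) := ⟨by omega⟩
  obtain ⟨c, β⟩ := u
  set g := torusHom (s' - s) (s' - s) (half c, 0) with hg
  have hsucc : torusHom (s' - s) (s' - s) (half c + 1, 0) = g + (s' - s) := torusHom_add_one_fst _ _ _ _
  -- `c ≠ c + 1` and `c - 1 ≠ c` in `ℤ_{2p}`, `2p ≥ 4`
  have hone : (1 : ZMod (2 * addOrderOf (s' - s))) ≠ 0 := by
    intro e
    have := congrArg ZMod.val e
    rw [ZMod.val_one_eq_one_mod, ZMod.val_zero, Nat.mod_eq_of_lt (by omega)] at this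
    exact one_ne_zero this
  have hc1 : c ≠ c + 1 := fun e => hone (by simpa using e.symm)
  have hc2 : c - 1 ≠ c := fun e => hone (by simpa using (sub_eq_self.mp e))
  -- parity bookkeeping for the predecessor `c - 1`
  have hpred_even : par c = false → par (c - 1) = true ∧ half c = half (c - 1) + 1 := by
    intro hpc
    have hpo : par (c - 1) = true := by
      by_contra hne
      have := (half_par_add_one_of_even (c - 1) (by simpa using hne)).2
      rw [sub_add_cancel] at this; rw [this] at hpc; exact Bool.noConfusion hpc
    have := (half_par_add_one_of_odd (c - 1) hpo).1
    rw [sub_add_cancel] at this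
    exact ⟨hpo, this⟩
  have hpred_odd : par c = true → par (c - 1) = false ∧ half c = half (c - 1) := by
    intro hpc
    have hpe : par (c - 1) = false := by
      by_contra hne
      have := (half_par_add_one_of_odd (c - 1) (by simpa using hne)).2
      rw [sub_add_cancel] at this; rw [this] at hpc; exact Bool.noConfusion hpc
    have := (half_par_add_one_of_even (c - 1) hpe).1
    rw [sub_add_cancel] at this
    exact ⟨hpe, this⟩
  -- the group element one step back along the cycle
  have hback : ∀ {k : ZMod (addOrderOf (s' - s))}, half c = k + 1 →
      torusHom (s' - s) (s' - s) (k, 0) = g - (s' - s) := by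
    intro k hk
    have := torusHom_add_one_fst (s' - s) (s' - s) k 0
    rw [← hk, ← hg] at this
    rw [this, add_sub_cancel_right]
  have adjL : (prismGraph (2 * addOrderOf (s' - s))).Adj (c, β) (c - 1, β) := by
    rw [prismGraph_adj_iff]; exact Or.inl ⟨hc2.symm, Or.inr (sub_add_cancel c 1).symm, rfl⟩
  have adjR : (prismGraph (2 * addOrderOf (s' - s))).Adj (c, β) (c + 1, β) := by
    rw [prismGraph_adj_iff]; exact Or.inl ⟨hc1, Or.inl rfl, rfl⟩
  have adjS : (prismGraph (2 * addOrderOf (s' - s))).Adj (c, β) (c, !β) := by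
    rw [prismGraph_adj_iff]; exact Or.inr ⟨by cases β <;> simp, rfl⟩
  cases β <;> cases hpc : par c
  · -- outer layer, even position: the vertex `X (i - g)`
    rw [wheelMap_apply, hpc, wheelVertex, ← hg, adj_vX_iff_pair21 ha hb] at h
    obtain ⟨hh1, hp1⟩ := half_par_add_one_of_even c hpc
    obtain ⟨hpo, hh2⟩ := hpred_even hpc
    rcases h with rfl | rfl | rfl
    · refine ⟨(c - 1, false), adjL, ?_⟩
      rw [wheelMap_apply, hpo, wheelVertex, hback hh2]; congr 1; abel
    · refine ⟨(c + 1, false), adjR, ?_⟩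
      rw [wheelMap_apply, hp1, hh1, wheelVertex, ← hg]
    · refine ⟨(c, true), adjS, ?_⟩
      rw [wheelMap_apply, hpc, wheelVertex, ← hg]
  · -- outer layer, odd position: the vertex `L (i - g - s')`
    rw [wheelMap_apply, hpc, wheelVertex, ← hg, adj_vL_iff_pair21 ha hb] at h
    obtain ⟨hh1, hp1⟩ := half_par_add_one_of_odd c hpc
    obtain ⟨hpe, hh2⟩ := hpred_odd hpc
    rcases h with rfl | rfl | rfl
    · refine ⟨(c + 1, false), adjR, ?_⟩
      rw [wheelMap_apply, hp1, hh1, wheelVertex, hsucc]; congr 1; abel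
    · refine ⟨(c - 1, false), adjL, ?_⟩
      rw [wheelMap_apply, hpe, ← hh2, wheelVertex, ← hg]; congr 1; abel
    · refine ⟨(c, true), adjS, ?_⟩
      rw [wheelMap_apply, hpc, wheelVertex, ← hg]
  · -- inner layer, even position: the vertex `R (i - g - t)`
    rw [wheelMap_apply, hpc, wheelVertex, ← hg, adj_vR_iff_pair21 ha hb] at h
    obtain ⟨hh1, hp1⟩ := half_par_add_one_of_even c hpc
    obtain ⟨hpo, hh2⟩ := hpred_even hpc
    rcases h with rfl | rfl | rfl
    · refine ⟨(c - 1, true), adjL, ?_⟩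
      rw [wheelMap_apply, hpo, wheelVertex, hback hh2]; congr 1; abel
    · refine ⟨(c + 1, true), adjR, ?_⟩
      rw [wheelMap_apply, hp1, hh1, wheelVertex, ← hg]; congr 1; abel
    · refine ⟨(c, false), adjS, ?_⟩
      rw [wheelMap_apply, hpc, wheelVertex, ← hg]; congr 1; abel
  · -- inner layer, odd position: the vertex `Z (i - g - s' - t)`
    rw [wheelMap_apply, hpc, wheelVertex, ← hg, adj_vZ_iff_pair21 ha hb] at h
    obtain ⟨hh1, hp1⟩ := half_par_add_one_of_odd c hpc
    obtain ⟨hpe, hh2⟩ := hpred_odd hpc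
    rcases h with rfl | rfl | rfl
    · refine ⟨(c + 1, true), adjR, ?_⟩
      rw [wheelMap_apply, hp1, hh1, wheelVertex, hsucc]; congr 1; abel
    · refine ⟨(c - 1, true), adjL, ?_⟩
      rw [wheelMap_apply, hpe, ← hh2, wheelVertex, ← hg]; congr 1; abel
    · refine ⟨(c, false), adjS, ?_⟩
      rw [wheelMap_apply, hpc, wheelVertex, ← hg]; congr 1; abel

end WheelLocal

end AbelianTwoBlock

end Literature.InformationTheory.QuantumCodes
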